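import Summits.QuantumFields.BalabanUV.T4Continuum.Support.NE7K1LinSchurLineForm

/-!
# NE7K1LinSchurFold — row NE7 (node U5), candidate route HOM, path H1L, cell K1-lin(s): THE HARD SCHUR COMPLEMENT IS
# CHART-FREE AND INTERTWINES — an algebraic «LEMMA F» (NEEDS-ESTIMATE #E1, input I2 of lens 2, abstract half)

Lineage `b2b-balaban-t4-ne7-p2` (CRUX PROVER NE7 #2), generation 72; file 30.  PRICING-NE7 v29 §216 (N-30-1) locates
NEEDS-ESTIMATE #E1 «REG-LINE(s)» as R-E1 ⊕ B-E1 ⊕ I2 ⊕ I3, with I2 = «the Neumann-box hard block-mean Schur complement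
`K_L^Π` is the `2^D`-image fold of the doubled-torus one» (t4-ne7-idea-2 g58, `I2I3-SUPPLY.md` §2; verified EXACTLY in `ℚ` by
the desk ×7 and by lens 1 13∕13; on paper via «LEMMA F»: group averaging + convexity).  THIS FILE is the abstract half of I2
IN KERNEL, and it REPLACES the group-averaging argument by pure matrix algebra:

* §1 `schurC H = H₁₁ − H₁₂H₂₂⁻¹H₂₁` (the tree's `lineOpR P₀ H₁₁ H₁₂ H₂₁ H₂₂ s = (1−s)P₀ + s·schurC H`, `lineOpR_eq_schurC`) and
  **`mulVec_kkt`**: `H(V, −H₂₂⁻¹H₂₁V) = (schurC H·V, 0)`.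
* §2 THE CHART OPERATOR `chartOp c T M = c·TᵀMT` of a fine operator `M` in a chart `T` (fine field `φ = T(V,ψ)`) whose
  `V`-coordinate is read by a «block-sum» matrix `S` (`S·T(V,ψ) = ℓ·V` — the tree's `NE7K1LinTwoRunKit.blockSum_coordT` with
  `ℓ = L^{d+1}`), `T` surjective: **`kkt_field`** — the field `φ_* = T(V, −H₂₂⁻¹H₂₁V)` satisfies the Karush–Kuhn–Tucker system
  `Sφ_* = ℓV`, `c·Mφ_* = ℓ⁻¹·Sᵀ(schurC H·V)`; **`kkt_unique`** — conversely `Sφ = ℓV ∧ c·Mφ = ℓ⁻¹Sᵀz` forces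
  `z = schurC H·V`.  So the hard Schur complement depends on `(M, S)` only, not on the chart (lens 2's located caveat «the
  anchor chart `coordT` is NOT reflection-covariant» is thereby moot).
* §3 **`schurC_intertwine`** — «LEMMA F», algebraic form: two such data `(T,S,M)` and `(T′,S′,M′)` with the same `c, ℓ` and two
  matrices `E` (fine) and `E_c` (coarse) with the THREE ENTRY-LEVEL INTERTWININGS `M′E = EM`, `S′E = E_cS`, `ESᵀ = S′ᵀE_c` have
  `schurC H′ · E_c = E_c · schurC H`; **`lineOpR_intertwine`** (the whole two-cutoff line, given `P′E_c = E_cP` for the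
  coarse operators), `inv_intertwine` (inverses), and the IMAGES FORM **`apply_fold_eq_sum_of_intertwine`**: for the 0∕1
  matrix `E_c = [f x = y]` of a map `f`, `X′E_c = E_cX` reads `X(f x₀, y) = Σ_{x : f x = y} X′(x₀, x)`.

HONEST FRAMING: [folklore] linear algebra (finite-dimensional KKT); no estimate; nothing of Bałaban's asserted; no `sorry`.
Census only (I2's abstract half; the concrete half — torus Laplacian, unfold matrices, the three intertwinings — is files
31–33); NE7 NOT PRINTED ∕ NOT PROVED; spine 0∕9; FIXED FINITE T⁴, rung (B)+1; NOT infinite volume, NOT mass gap, NOT Clay.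
HONEST DEPENDENCY: continuum YM on T⁴ ⇐ BetaPertH ∧ nine spine estimates (0/9 proved); BetaPertH ⇐ (D1) ∧ (D4) ∧ CAP+tail;
G-an2-4 gates asym, D1 and NE2/3/4.
-/

noncomputable section

open Finset Matrix

namespace Summit.QuantumFields.BalabanUV.T4Continuum.NE7K1LinSchurFold

open NE7K1LinSchurLineForm

/-! ### §0 Two matrix facts -/

/-- two matrices with the same action on vectors are equal. [folklore] -/
theorem ext_of_mulVec {m n : Type*} [Fintype n] [DecidableEq n] {M N : Matrix m n ℝ} (h : ∀ v, M *ᵥ v = N *ᵥ v) :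
    M = N := by
  ext i j
  have := congrFun (h (Pi.single j 1)) i
  rwa [Matrix.mulVec_single_one, Matrix.mulVec_single_one] at this

/-- `Tᵀ` is injective on vectors when `T` is surjective on vectors. [folklore] -/
theorem transpose_mulVec_injective {ι κ : Type*} [Fintype ι] [Fintype κ] {T : Matrix ι κ ℝ}
    (hT : ∀ φ : ι → ℝ, ∃ u, T *ᵥ u = φ) {w w' : ι → ℝ} (h : Tᵀ *ᵥ w = Tᵀ *ᵥ w') : w = w' := by
  have key : ∀ φ : ι → ℝ, φ ⬝ᵥ w = φ ⬝ᵥ w' := by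
    intro φ
    obtain ⟨u, rfl⟩ := hT φ
    have e : ∀ w₀ : ι → ℝ, (T *ᵥ u) ⬝ᵥ w₀ = (Tᵀ *ᵥ w₀) ⬝ᵥ u := fun w₀ => by
      rw [dotProduct_comm, Matrix.dotProduct_mulVec, Matrix.mulVec_transpose]
    rw [e, e, h]
  have h0 : (w - w') ⬝ᵥ (w - w') = 0 := by
    rw [dotProduct_sub, key (w - w'), sub_self]
  exact sub_eq_zero.1 (dotProduct_self_eq_zero.1 h0)

/-! ### §1 The Schur complement over the fluctuation block and its KKT vector -/

/-- the SCHUR COMPLEMENT of a block matrix over its second (fluctuation) block: `H₁₁ − H₁₂·H₂₂⁻¹·H₂₁`. [folklore] -/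
def schurC {κc κf : Type*} [Fintype κf] [DecidableEq κf] (H : Matrix (κc ⊕ κf) (κc ⊕ κf) ℝ) : Matrix κc κc ℝ :=
  H.toBlocks₁₁ - H.toBlocks₁₂ * (H.toBlocks₂₂)⁻¹ * H.toBlocks₂₁

/-- the tree's two-cutoff line over the blocks of `H` is `(1−s)P₀ + s·schurC H`. [folklore] -/
theorem lineOpR_eq_schurC {κc κf : Type*} [Fintype κf] [DecidableEq κf] (P₀ : Matrix κc κc ℝ)
    (H : Matrix (κc ⊕ κf) (κc ⊕ κf) ℝ) (s : ℝ) :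
    lineOpR P₀ H.toBlocks₁₁ H.toBlocks₁₂ H.toBlocks₂₁ H.toBlocks₂₂ s = (1 - s) • P₀ + s • schurC H := rfl

/-- completing the square, vector form, for a block matrix: `[[A,B],[C,D]](V, −D⁻¹CV) = ((A − BD⁻¹C)V, 0)`. [folklore] -/
theorem fromBlocks_mulVec_kkt {κc κf : Type*} [Fintype κc] [Fintype κf] [DecidableEq κf] (A : Matrix κc κc ℝ)
    (B : Matrix κc κf ℝ) (C : Matrix κf κc ℝ) (D : Matrix κf κf ℝ) (hD : IsUnit D.det) (V : κc → ℝ) :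
    Matrix.fromBlocks A B C D *ᵥ Sum.elim V (-(D⁻¹ *ᵥ (C *ᵥ V))) = Sum.elim ((A - B * D⁻¹ * C) *ᵥ V) 0 := by
  rw [Matrix.fromBlocks_mulVec, Sum.elim_comp_inl, Sum.elim_comp_inr]
  congr 1
  · rw [Matrix.sub_mulVec, Matrix.mul_assoc, ← Matrix.mulVec_mulVec, ← Matrix.mulVec_mulVec, Matrix.mulVec_neg,
      sub_eq_add_neg]
  · rw [Matrix.mulVec_neg, Matrix.mulVec_mulVec, Matrix.mul_nonsing_inv _ hD, Matrix.one_mulVec, add_neg_cancel]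

/-- **COMPLETING THE SQUARE, vector form**: `H(V, −H₂₂⁻¹H₂₁V) = (schurC H·V, 0)` (`H₂₂` invertible). [folklore] -/
theorem mulVec_kkt {κc κf : Type*} [Fintype κc] [Fintype κf] [DecidableEq κf] (H : Matrix (κc ⊕ κf) (κc ⊕ κf) ℝ)
    (hD : IsUnit (H.toBlocks₂₂).det) (V : κc → ℝ) :
    H *ᵥ Sum.elim V (-((H.toBlocks₂₂)⁻¹ *ᵥ (H.toBlocks₂₁ *ᵥ V))) = Sum.elim (schurC H *ᵥ V) 0 := by
  have h := fromBlocks_mulVec_kkt H.toBlocks₁₁ H.toBlocks₁₂ H.toBlocks₂₁ H.toBlocks₂₂ hD V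
  rwa [Matrix.fromBlocks_toBlocks] at h

/-! ### §2 The chart operator `c·TᵀMT`, the block-sum read-out, and the KKT characterisation -/

/-- the CHART OPERATOR `c·TᵀMT` of a fine operator `M` in the chart `T` (the tree's `runB` is
`chartOp (L^{d+1})⁻¹ (coordT ·) (fineOpR (nL) a 0 R′)`). [folklore] -/
def chartOp {ι κc κf : Type*} [Fintype ι] (c : ℝ) (T : Matrix ι (κc ⊕ κf) ℝ) (M : Matrix ι ι ℝ) :
    Matrix (κc ⊕ κf) (κc ⊕ κf) ℝ :=
  c • (Tᵀ * M * T)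

/-- the KKT FIELD of the datum `V`: `φ_* = T(V, −H₂₂⁻¹H₂₁V)`, `H = chartOp c T M` (the constrained minimiser when `H ≥ 0`).
[folklore] -/
def kktField {ι κc κf : Type*} [Fintype ι] [Fintype κc] [Fintype κf] [DecidableEq κf] (c : ℝ) (T : Matrix ι (κc ⊕ κf) ℝ)
    (M : Matrix ι ι ℝ) (V : κc → ℝ) : ι → ℝ :=
  T *ᵥ Sum.elim V (-(((chartOp c T M).toBlocks₂₂)⁻¹ *ᵥ ((chartOp c T M).toBlocks₂₁ *ᵥ V)))

section Chart

variable {ι κc κf : Type*} [Fintype ι] [Fintype κc] [Fintype κf]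
variable {c ℓ : ℝ} {T : Matrix ι (κc ⊕ κf) ℝ} {S : Matrix κc ι ℝ} {M : Matrix ι ι ℝ}

/-- the chart operator on a chart vector: `H u = c·Tᵀ(M(Tu))`. [folklore] -/
theorem chartOp_mulVec (c : ℝ) (T : Matrix ι (κc ⊕ κf) ℝ) (M : Matrix ι ι ℝ) (u : κc ⊕ κf → ℝ) :
    chartOp c T M *ᵥ u = c • (Tᵀ *ᵥ (M *ᵥ (T *ᵥ u))) := by
  rw [chartOp, Matrix.smul_mulVec, Matrix.mulVec_mulVec, Matrix.mulVec_mulVec]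

/-- entries of `S·T` from the read-out identity `S·T(V,ψ) = ℓ·V`. [folklore] -/
theorem bsum_mul_chart_apply [DecidableEq κc] [DecidableEq κf]
    (hST : ∀ u : κc ⊕ κf → ℝ, S *ᵥ (T *ᵥ u) = fun b => ℓ * u (Sum.inl b)) (b : κc) (j : κc ⊕ κf) :
    (S * T) b j = ℓ * (Pi.single j (1 : ℝ) : κc ⊕ κf → ℝ) (Sum.inl b) := by
  have := congrFun (hST (Pi.single j 1)) b
  rwa [Matrix.mulVec_mulVec, Matrix.mulVec_single_one] at this

/-- `Tᵀ(Sᵀz) = (ℓ·z, 0)`: the transpose of the read-out identity. [folklore] -/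
theorem transpose_mulVec_transpose [DecidableEq κc] [DecidableEq κf]
    (hST : ∀ u : κc ⊕ κf → ℝ, S *ᵥ (T *ᵥ u) = fun b => ℓ * u (Sum.inl b)) (z : κc → ℝ) :
    Tᵀ *ᵥ (Sᵀ *ᵥ z) = Sum.elim (ℓ • z) 0 := by
  rw [Matrix.mulVec_mulVec, ← Matrix.transpose_mul]
  ext j
  simp only [Matrix.mulVec, dotProduct, Matrix.transpose_apply, bsum_mul_chart_apply hST]
  rcases j with b' | f
  · simp only [Sum.elim_inl, Pi.smul_apply, smul_eq_mul, Pi.single_apply, Sum.inl.injEq]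
    rw [Finset.sum_eq_single b']
    · simp
    · intro b _ hb; simp [hb]
    · intro h; exact absurd (Finset.mem_univ _) h
  · simp

/-- the read-out of the KKT field: `S φ_* = ℓ·V`. [folklore] -/
theorem bsum_kktField [DecidableEq κf] (hST : ∀ u : κc ⊕ κf → ℝ, S *ᵥ (T *ᵥ u) = fun b => ℓ * u (Sum.inl b))
    (V : κc → ℝ) : S *ᵥ kktField c T M V = ℓ • V := by
  rw [kktField, hST]
  ext b
  simp

/-- **THE KKT SYSTEM OF THE HARD SCHUR COMPLEMENT**: `c·M φ_* = ℓ⁻¹·Sᵀ(schurC H · V)` — the fine operator applied to the KKT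
field is a pure «multiplier» (in the range of `Sᵀ`), and the multiplier IS the Schur complement. [folklore] -/
theorem kkt_field [DecidableEq κc] [DecidableEq κf]
    (hST : ∀ u : κc ⊕ κf → ℝ, S *ᵥ (T *ᵥ u) = fun b => ℓ * u (Sum.inl b)) (hT : ∀ φ : ι → ℝ, ∃ u, T *ᵥ u = φ)
    (hℓ : ℓ ≠ 0) (hD : IsUnit ((chartOp c T M).toBlocks₂₂).det) (V : κc → ℝ) :
    c • (M *ᵥ kktField c T M V) = ℓ⁻¹ • (Sᵀ *ᵥ (schurC (chartOp c T M) *ᵥ V)) := by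
  apply transpose_mulVec_injective hT
  rw [Matrix.mulVec_smul, Matrix.mulVec_smul, transpose_mulVec_transpose hST, kktField, ← chartOp_mulVec,
    mulVec_kkt _ hD]
  ext j
  rcases j with b | f
  · simp [hℓ]
  · simp

/-- **UNIQUENESS OF THE KKT SYSTEM**: if `Sφ = ℓV` and `c·Mφ = ℓ⁻¹Sᵀz` then `z = schurC H · V` (the multiplier is determined;
`T` surjective, `H₂₂` invertible). [folklore] -/
theorem kkt_unique [DecidableEq κc] [DecidableEq κf]
    (hST : ∀ u : κc ⊕ κf → ℝ, S *ᵥ (T *ᵥ u) = fun b => ℓ * u (Sum.inl b)) (hT : ∀ φ : ι → ℝ, ∃ u, T *ᵥ u = φ)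
    (hℓ : ℓ ≠ 0) (hD : IsUnit ((chartOp c T M).toBlocks₂₂).det) {V z : κc → ℝ} {φ : ι → ℝ}
    (hSφ : S *ᵥ φ = ℓ • V) (hMφ : c • (M *ᵥ φ) = ℓ⁻¹ • (Sᵀ *ᵥ z)) : z = schurC (chartOp c T M) *ᵥ V := by
  obtain ⟨u, rfl⟩ := hT φ
  set H := chartOp c T M with hH
  -- the coarse coordinate of `u` is `V`
  have hV : (fun b => u (Sum.inl b)) = V := by
    have h1 := hST u
    rw [hSφ] at h1
    ext b
    have := congrFun h1 b
    simp only [Pi.smul_apply, smul_eq_mul] at this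
    exact (mul_right_inj' hℓ).1 this.symm
  -- `H u = (z, 0)`
  have hHu : H *ᵥ u = Sum.elim z 0 := by
    rw [hH, chartOp_mulVec, ← Matrix.mulVec_smul, hMφ, Matrix.mulVec_smul, transpose_mulVec_transpose hST]
    ext j
    rcases j with b | f
    · simp [hℓ]
    · simp
  -- in blocks
  have hu : u = Sum.elim (fun b => u (Sum.inl b)) (fun f => u (Sum.inr f)) := by
    ext j; rcases j with b | f <;> rfl
  rw [hu, ← Matrix.fromBlocks_toBlocks H, Matrix.fromBlocks_mulVec, Sum.elim_comp_inl, Sum.elim_comp_inr, hV] at hHu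
  have h1 := congrArg (fun w => w ∘ Sum.inl) hHu
  have h2 := congrArg (fun w => w ∘ Sum.inr) hHu
  simp only [Sum.elim_comp_inl, Sum.elim_comp_inr] at h1 h2
  -- solve the fluctuation equation
  have hψ : (fun f => u (Sum.inr f)) = -((H.toBlocks₂₂)⁻¹ *ᵥ (H.toBlocks₂₁ *ᵥ V)) := by
    have h3 : H.toBlocks₂₂ *ᵥ (fun f => u (Sum.inr f)) = -(H.toBlocks₂₁ *ᵥ V) := eq_neg_of_add_eq_zero_right h2
    have h4 := congrArg (fun w => (H.toBlocks₂₂)⁻¹ *ᵥ w) h3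
    simp only [Matrix.mulVec_mulVec, Matrix.nonsing_inv_mul _ hD, Matrix.one_mulVec] at h4
    rw [h4, Matrix.mulVec_neg]
  rw [← h1, hψ, schurC, Matrix.sub_mulVec, Matrix.mul_assoc, ← Matrix.mulVec_mulVec, ← Matrix.mulVec_mulVec,
    Matrix.mulVec_neg, sub_eq_add_neg]

end Chart

/-! ### §3 «LEMMA F»: three entry-level intertwinings ⇒ the hard Schur complements intertwine -/

section Intertwine

variable {ι κc κf : Type*} [Fintype ι] [Fintype κc] [Fintype κf] [DecidableEq κc] [DecidableEq κf]
variable {ι' κc' κf' : Type*} [Fintype ι'] [Fintype κc'] [Fintype κf'] [DecidableEq κc'] [DecidableEq κf']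
variable {c ℓ : ℝ} {T : Matrix ι (κc ⊕ κf) ℝ} {S : Matrix κc ι ℝ} {M : Matrix ι ι ℝ}
variable {T' : Matrix ι' (κc' ⊕ κf') ℝ} {S' : Matrix κc' ι' ℝ} {M' : Matrix ι' ι' ℝ}
variable {E : Matrix ι' ι ℝ} {Ec : Matrix κc' κc ℝ}

/-- **«LEMMA F» (algebraic form): THE HARD SCHUR COMPLEMENTS INTERTWINE.**  Two chart data `(T, S, M)`, `(T′, S′, M′)` with the
read-out identities `S·T(V,ψ) = ℓV`, `S′·T′(V′,ψ′) = ℓV′`, surjective charts, invertible fluctuation blocks, and two matrices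
`E` (fine), `E_c` (coarse) with `M′E = EM`, `S′E = E_cS`, `ESᵀ = S′ᵀE_c`.  Then `schurC H′ · E_c = E_c · schurC H`.  (Proof:
`E` carries the KKT field of `V` to a solution of the primed KKT system for `E_cV` with multiplier `E_c(schurC H·V)`;
uniqueness.) [folklore] -/
theorem schurC_intertwine
    (hST : ∀ u : κc ⊕ κf → ℝ, S *ᵥ (T *ᵥ u) = fun b => ℓ * u (Sum.inl b)) (hT : ∀ φ : ι → ℝ, ∃ u, T *ᵥ u = φ)
    (hST' : ∀ u : κc' ⊕ κf' → ℝ, S' *ᵥ (T' *ᵥ u) = fun b => ℓ * u (Sum.inl b)) (hT' : ∀ φ : ι' → ℝ, ∃ u, T' *ᵥ u = φ)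
    (hℓ : ℓ ≠ 0) (hD : IsUnit ((chartOp c T M).toBlocks₂₂).det) (hD' : IsUnit ((chartOp c T' M').toBlocks₂₂).det)
    (hME : M' * E = E * M) (hSE : S' * E = Ec * S) (hES : E * Sᵀ = S'ᵀ * Ec) :
    schurC (chartOp c T' M') * Ec = Ec * schurC (chartOp c T M) := by
  refine ext_of_mulVec fun V => ?_
  rw [← Matrix.mulVec_mulVec, ← Matrix.mulVec_mulVec]
  symm
  refine kkt_unique hST' hT' hℓ hD' (φ := E *ᵥ kktField c T M V) ?_ ?_
  · rw [Matrix.mulVec_mulVec, hSE, ← Matrix.mulVec_mulVec, bsum_kktField hST, Matrix.mulVec_smul]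
  · rw [Matrix.mulVec_mulVec, hME, ← Matrix.mulVec_mulVec, ← Matrix.mulVec_smul, kkt_field hST hT hℓ hD,
      Matrix.mulVec_smul, Matrix.mulVec_mulVec, hES, ← Matrix.mulVec_mulVec]

/-- **THE TWO-CUTOFF LINES INTERTWINE**: with, in addition, `P′E_c = E_cP` for the coarse operators, the lines
`(1−s)P + s·schurC H` intertwine for every `s`. [folklore] -/
theorem lineOpR_intertwine {P : Matrix κc κc ℝ} {P' : Matrix κc' κc' ℝ}
    (hST : ∀ u : κc ⊕ κf → ℝ, S *ᵥ (T *ᵥ u) = fun b => ℓ * u (Sum.inl b)) (hT : ∀ φ : ι → ℝ, ∃ u, T *ᵥ u = φ)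
    (hST' : ∀ u : κc' ⊕ κf' → ℝ, S' *ᵥ (T' *ᵥ u) = fun b => ℓ * u (Sum.inl b)) (hT' : ∀ φ : ι' → ℝ, ∃ u, T' *ᵥ u = φ)
    (hℓ : ℓ ≠ 0) (hD : IsUnit ((chartOp c T M).toBlocks₂₂).det) (hD' : IsUnit ((chartOp c T' M').toBlocks₂₂).det)
    (hME : M' * E = E * M) (hSE : S' * E = Ec * S) (hES : E * Sᵀ = S'ᵀ * Ec) (hPE : P' * Ec = Ec * P) (s : ℝ) :
    lineOpR P' (chartOp c T' M').toBlocks₁₁ (chartOp c T' M').toBlocks₁₂ (chartOp c T' M').toBlocks₂₁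
        (chartOp c T' M').toBlocks₂₂ s * Ec =
      Ec * lineOpR P (chartOp c T M).toBlocks₁₁ (chartOp c T M).toBlocks₁₂ (chartOp c T M).toBlocks₂₁
        (chartOp c T M).toBlocks₂₂ s := by
  rw [lineOpR_eq_schurC, lineOpR_eq_schurC, Matrix.add_mul, Matrix.mul_add, Matrix.smul_mul, Matrix.smul_mul,
    Matrix.mul_smul, Matrix.mul_smul, hPE, schurC_intertwine hST hT hST' hT' hℓ hD hD' hME hSE hES]

end Intertwine

section Images

variable {κc κc' : Type*} [Fintype κc] [Fintype κc']

/-- inverses intertwine when the operators do. [folklore] -/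
theorem inv_intertwine [DecidableEq κc] [DecidableEq κc'] {X : Matrix κc κc ℝ} {X' : Matrix κc' κc' ℝ}
    {Ec : Matrix κc' κc ℝ} (h : X' * Ec = Ec * X) (hX : IsUnit X.det) (hX' : IsUnit X'.det) :
    X'⁻¹ * Ec = Ec * X⁻¹ := by
  calc X'⁻¹ * Ec = X'⁻¹ * Ec * (X * X⁻¹) := by rw [Matrix.mul_nonsing_inv _ hX, Matrix.mul_one]
    _ = X'⁻¹ * (X' * Ec) * X⁻¹ := by rw [h]; simp only [Matrix.mul_assoc]
    _ = Ec * X⁻¹ := by rw [← Matrix.mul_assoc, Matrix.nonsing_inv_mul _ hX', Matrix.one_mul]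

/-- **THE IMAGES FORM of an intertwining with a 0∕1 «unfold» matrix** `E_c(x, y) = [f x = y]`:
`X(f x₀, y) = Σ_{x : f x = y} X′(x₀, x)`. [folklore] -/
theorem apply_fold_eq_sum_of_intertwine [DecidableEq κc] {X : Matrix κc κc ℝ} {X' : Matrix κc' κc' ℝ} (f : κc' → κc)
    (h : X' * (Matrix.of fun x y => if f x = y then (1 : ℝ) else 0) =
      (Matrix.of fun x y => if f x = y then (1 : ℝ) else 0) * X)
    (x₀ : κc') (y : κc) : X (f x₀) y = ∑ x ∈ Finset.univ.filter (fun x => f x = y), X' x₀ x := by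
  have := congrFun (congrFun h x₀) y
  simp only [Matrix.mul_apply, Matrix.of_apply, mul_ite, mul_one, mul_zero, ite_mul, one_mul, zero_mul,
    Finset.sum_ite_eq, Finset.mem_univ, if_true] at this
  rw [Finset.sum_filter, this]

end Images

end Summit.QuantumFields.BalabanUV.T4Continuum.NE7K1LinSchurFold

end
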